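import Literature.Analysis.FluidPDE.TsaiMaximumPrinciple
import HarnessLib

/-!
# GaldiLiouvilleGateGaldiLiouvilleDriftMaximumPrinciple — census row S1 ⟨0895⟩ `GaldiLiouville`, line «allaxes»
# (ns-idea-4 g8): the Liouville step of support O2 `AxialRigidity` (ns-s29-p2 g3, DIRECTOR-NS #209 (2))

A reusable elliptic tool for the steady-Liouville lines of `GaldiLiouvilleGate` (namespace of line allaxes): **Liouville by
the perturbed weak maximum principle for drift–Laplace subsolutions on `ℝ³`.**  With Tsai's operator
`driftOp ν a U f = ν Δf − Df[U + a y]` (`Literature.Analysis.FluidPDE.TsaiMaximumPrinciple`) at `a = 0`: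

* `driftOp_nonpos_of_isLocalMax` — at a LOCAL maximum of a `C²` function, `νΔV − DV[U] ≤ 0` (`∇V = 0`, `ΔV ≤ 0`;
  the tree's `driftOp_nonpos_of_isMax` asks a global maximum);
* `le_of_driftOp_nonneg_of_tendsto` — if `Θ ∈ C²(ℝ³)` satisfies `νΔΘ − DΘ[U] ≥ 0` with `ν > 0` and `U` bounded, and
  `Θ → c` at infinity, then `Θ ≤ c`.  Proof: for `Θ(x₁) = c + δ`, `δ > 0`, perturb by `ε e^{k|y−x₁|²}` with `k > M²/ν²`
  (a strict supersolution by `driftOp_gaussAt`: the quadratic `4νk r² − 2Mr + 6ν` has negative discriminant) and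
  `ε e^{k(R+|x₁|)²} = δ/4`; the perturbed function has `L > 0`, hence no interior maximum on the ball `B̄(0,R)`, while on
  the sphere it is `< c + δ/2` once `Θ < c + δ/4` there — contradiction with its value `≥ c + δ` at `x₁`.

Used by `…GaldiLiouvilleAxialRigidity` (O2 of line allaxes) on the head pressure `Θ = ½|U|² + P` of a steady D-solution
with constant pressure (Tsai 1998 (1.7): `LΘ = ν|curl U|² ≥ 0`).

WHAT THIS IS NOT: elliptic bookkeeping; nothing about ⟨0895⟩, census row S1 or Navier–Stokes regularity is proved here.
[folklore; GilbargTrudinger2001 §3.1; LemarieRieusset2016 Lemma 16.8 (proof pattern)]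
-/

noncomputable section

open MeasureTheory Set Filter Topology Function Metric
open scoped ENNReal InnerProductSpace RealInnerProductSpace Laplacian ContDiff

set_option linter.dupNamespace false

namespace Summit.NavierStokesRegularity.NavierStokesRegularity.Theorems.GaldiLiouville.AllAxesBudget

open Literature.Analysis.FluidPDE

/-- At a LOCAL maximum of a `C²` function the drift–Laplace operator is `≤ 0` (`∇V = 0`, `ΔV ≤ 0`). [folklore] -/
theorem driftOp_nonpos_of_isLocalMax {ν a : ℝ} (hν : 0 ≤ ν) (U : EuclideanSpace ℝ (Fin 3) → EuclideanSpace ℝ (Fin 3))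
    {V : EuclideanSpace ℝ (Fin 3) → ℝ} (hV : ContDiff ℝ 2 V) {x : EuclideanSpace ℝ (Fin 3)} (hmax : IsLocalMax V x) :
    driftOp ν a U V x ≤ 0 := by
  unfold driftOp
  rw [hmax.fderiv_eq_zero, zero_apply, sub_zero]
  exact mul_nonpos_of_nonneg_of_nonpos hν (laplacian_nonpos_of_isLocalMax hV hmax)

/-- **Liouville by the perturbed weak maximum principle**: a `C²` function `Π` with `LΠ ≥ 0` for `L = νΔ − U·∇`
(`ν > 0`, `U` bounded) which tends to `c` at infinity satisfies `Π ≤ c` everywhere.  (Perturb by `ε e^{k|y−x₁|²}`,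
`k > M²/ν²`, which is a strict supersolution: `L(Π + εψ) > 0` has no interior maximum on a ball, so the maximum
over a large ball sits on the sphere, where `Π` is already `≤ c + δ/4`.) [folklore; GilbargTrudinger2001 §3.1] -/
theorem le_of_driftOp_nonneg_of_tendsto {ν : ℝ} (hν : 0 < ν) {U : EuclideanSpace ℝ (Fin 3) → EuclideanSpace ℝ (Fin 3)}
    {M : ℝ} (hM : ∀ y, ‖U y‖ ≤ M) {Θ : EuclideanSpace ℝ (Fin 3) → ℝ} (hΘ : ContDiff ℝ 2 Θ)
    (hL : ∀ y, 0 ≤ driftOp ν 0 U Θ y) {c : ℝ} (hlim : Tendsto Θ (cocompact (EuclideanSpace ℝ (Fin 3))) (𝓝 c)) :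
    ∀ x, Θ x ≤ c := by
  intro x₁
  by_contra hx₁'
  have hx₁ : c < Θ x₁ := not_le.1 hx₁'
  set δ : ℝ := Θ x₁ - c with hδ_def
  have hδ : 0 < δ := by rw [hδ_def]; linarith
  have hM0 : 0 ≤ M := (norm_nonneg _).trans (hM 0)
  -- the strict supersolution `ψ = e^{k|y − x₁|²}`
  set k : ℝ := M ^ 2 / ν ^ 2 + 1 with hk_def
  have hk : 0 < k := by positivity
  have hkM : M ^ 2 < ν ^ 2 * k := by
    rw [hk_def, mul_add, mul_div_cancel₀ _ (pow_ne_zero 2 hν.ne'), mul_one]; nlinarith [sq_nonneg ν, hν]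
  set ψ : EuclideanSpace ℝ (Fin 3) → ℝ := gaussAt k x₁ with hψ_def
  have hψ2 : ContDiff ℝ 2 ψ := contDiff_gaussAt k x₁
  have hLψ : ∀ y, 0 < driftOp ν 0 U ψ y := by
    intro y
    rw [hψ_def, driftOp_gaussAt, finrank_euclideanSpace_fin]
    refine mul_pos (gaussAt_pos k x₁ y) ?_
    set r : ℝ := ‖y - x₁‖ with hr_def
    have hr : 0 ≤ r := norm_nonneg _
    have hin : ⟪y - x₁, U y + (0 : ℝ) • y⟫ ≤ r * M := by
      rw [zero_smul, add_zero]
      exact (real_inner_le_norm _ _).trans (mul_le_mul_of_nonneg_left (hM y) hr)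
    -- `ν(4k²r² + 6k) − 2k r M > 0` because the quadratic `4νk r² − 2M r + 6ν` has negative discriminant
    have hquad : 0 < 4 * ν * k * r ^ 2 - 2 * M * r + 6 * ν := by
      nlinarith [sq_nonneg (4 * ν * k * r - M), hkM, hν, hk, sq_nonneg r, hr, hM0, mul_pos hν hk]
    have h3 : ((3 : ℕ) : ℝ) = 3 := by norm_num
    rw [h3]
    nlinarith [hin, hquad, hk]
  -- far out, `Θ ≤ c + δ/4`
  have hfar : ∀ᶠ y in cocompact (EuclideanSpace ℝ (Fin 3)), Θ y < c + δ / 4 :=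
    hlim (Iio_mem_nhds (by linarith))
  obtain ⟨K, hK, hKfar⟩ := (hasBasis_cocompact.eventually_iff).1 hfar
  obtain ⟨R₀, hR₀⟩ := hK.isBounded.subset_closedBall (0 : EuclideanSpace ℝ (Fin 3))
  have hfar' : ∀ y : EuclideanSpace ℝ (Fin 3), R₀ < ‖y‖ → Θ y < c + δ / 4 := by
    intro y hy
    have hyc : y ∈ Kᶜ := fun hyK => by
      have := hR₀ hyK
      rw [mem_closedBall, dist_zero_right] at this
      linarith
    exact hKfar hyc
  -- the ball `B̄(0, R)` with `x₁` inside and the sphere far out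
  set R : ℝ := max R₀ ‖x₁‖ + 1 with hR_def
  have hR₀R : R₀ < R := by rw [hR_def]; linarith [le_max_left R₀ ‖x₁‖]
  have hx₁R : ‖x₁‖ < R := by rw [hR_def]; linarith [le_max_right R₀ ‖x₁‖]
  have hx₁mem : x₁ ∈ closedBall (0 : EuclideanSpace ℝ (Fin 3)) R := by
    rw [mem_closedBall, dist_zero_right]; exact hx₁R.le
  -- the size of `ψ` on the ball
  set A : ℝ := Real.exp (k * (R + ‖x₁‖) ^ 2) with hA_def
  have hA : 0 < A := Real.exp_pos _
  have hψA : ∀ y : EuclideanSpace ℝ (Fin 3), ‖y‖ ≤ R → ψ y ≤ A := by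
    intro y hy
    rw [hψ_def, hA_def]
    unfold gaussAt
    refine Real.exp_le_exp.2 (mul_le_mul_of_nonneg_left ?_ hk.le)
    have h1 : ‖y - x₁‖ ≤ R + ‖x₁‖ := (norm_sub_le _ _).trans (by linarith)
    exact pow_le_pow_left₀ (norm_nonneg _) h1 2
  have hψ0 : ∀ y, 0 ≤ ψ y := fun y => (gaussAt_pos k x₁ y).le
  -- the perturbed function `W = Θ + ε ψ`
  set ε : ℝ := δ / 4 / A with hε_def
  have hε : 0 < ε := by positivity
  have hεA : ε * A = δ / 4 := by rw [hε_def]; field_simp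
  set W : EuclideanSpace ℝ (Fin 3) → ℝ := Θ + ε • (ψ - (0 : ℝ) • ψ) with hW_def
  have hWapp : ∀ y, W y = Θ y + ε * ψ y := by
    intro y
    simp [hW_def]
  have hW2 : ContDiff ℝ 2 W := hΘ.add (contDiff_const.smul (hψ2.sub (contDiff_const.smul hψ2)))
  have hLW : ∀ y, 0 < driftOp ν 0 U W y := by
    intro y
    rw [hW_def, driftOp_add_smul_sub ν 0 U hΘ hψ2 hψ2 ε 0 y, zero_mul, sub_zero]
    exact add_pos_of_nonneg_of_pos (hL y) (mul_pos hε (hLψ y))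
  -- the maximum of `W` over the closed ball
  obtain ⟨x₂, hx₂mem, hx₂max⟩ := (isCompact_closedBall (0 : EuclideanSpace ℝ (Fin 3)) R).exists_isMaxOn
    ⟨x₁, hx₁mem⟩ hW2.continuous.continuousOn
  have hx₂R : ‖x₂‖ ≤ R := by rw [mem_closedBall, dist_zero_right] at hx₂mem; exact hx₂mem
  by_cases hint : ‖x₂‖ < R
  · -- interior maximum: `LW(x₂) ≤ 0`, contradicting `LW > 0`
    have hloc : IsLocalMax W x₂ :=
      hx₂max.isLocalMax (closedBall_mem_nhds_of_mem (by rw [mem_ball, dist_zero_right]; exact hint))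
    exact absurd (driftOp_nonpos_of_isLocalMax hν.le U hW2 hloc) (not_le.2 (hLW x₂))
  · -- boundary maximum: `W x₁ ≤ W x₂ ≤ c + δ/4 + εA = c + δ/2 < Θ x₁ ≤ W x₁`
    have hx₂eq : R ≤ ‖x₂‖ := not_lt.1 hint
    have h1 : Θ x₂ < c + δ / 4 := hfar' x₂ (hR₀R.trans_le hx₂eq)
    have h2 : ε * ψ x₂ ≤ δ / 4 := by
      rw [← hεA]; exact mul_le_mul_of_nonneg_left (hψA x₂ hx₂R) hε.le
    have h3 : W x₁ ≤ W x₂ := hx₂max hx₁mem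
    have h4 : Θ x₁ ≤ W x₁ := by rw [hWapp]; linarith [mul_nonneg hε.le (hψ0 x₁)]
    rw [hWapp x₂] at h3
    linarith

end Summit.NavierStokesRegularity.NavierStokesRegularity.Theorems.GaldiLiouville.AllAxesBudget

end
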